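import Literature.RingTheory.MvPowerSeries.HasseDerivDiffOp
import Literature.RingTheory.MvPowerSeries.HasseDerivOrder
import Mathlib.Algebra.Order.Antidiag.Finsupp
import HarnessLib

/-!
# EGA IV₄ Thm. 16.11.2 for formal power series: the divided derivatives `Δ_α`, `|α| ≤ n`, form a
# basis of `Diff^{≤ n}_{A⟦X⟧/A}`

Topic `Literature/RingTheory/MvPowerSeries`, companion of `HasseDerivDiffOp.lean` (Leibniz rule,
`isDiffOpLE_hasseDeriv`: `Δ_α` is a differential operator of order `≤ |α|` of `A⟦X_s : s ∈ τ⟧` relative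
to `A`, in the sense of the tree's `Resolution.IsDiffOpLE`, EGA IV₄ 16.8.8 (b)) and of the POLYNOMIAL basis
theorem `Resolution.hasseSchmidtDiff_eq_diffOp_of_fintype` (`HasseSchmidtDiffEqDiffOp.lean`, EGA IV₄
Thm. 16.11.2 for `𝔸^σ_R`). For a FINITE index type `τ` and ANY commutative ring `A` this file proves the
power-series analogue:

* (values on monomials `Δ_α(c X^β) = C(β, α) c X^{β−α}`, zero unless `α ≤ β` — formula (16.11.2.1)
  «`D_p(z^q) = (q choose p) z^{q−p}`» / Hironaka 2005 (9.3) — are the tree's `hasseDeriv_monomial`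
  (`HasseDerivFrobenius.lean`), `hasseDeriv_monomial_of_not_le'`, `hasseDeriv_monomial_self'`
  (`HasseDerivOrder.lean`), used here);
* `linearIndependent_hasseDeriv` — the family `(Δ_α)_{α ∈ ℕ^τ}` is linearly independent over `A⟦X⟧`
  (read off the values on monomials, by induction on `|α|`);
* `eq_zero_of_isDiffOpLE_of_apply_monomial_eq_zero` — an operator of order `≤ n` vanishing on the
  monomials of degree `≤ n` is zero. As in the polynomial case the commutators `[E, X_i]` vanish by
  induction on `n`, so `E(X_i t) = X_i E(t)` and `E(1) = 0`; for power series one concludes not by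
  polynomial induction but by `(X)`-adic approximation: writing `f = f(0) + Σ_i X_i g_i`
  (`exists_eq_C_add_sum_X_mul`) gives `E f = Σ_i X_i E(g_i)`, whence by induction on `M` all
  coefficients of `E f` of degree `< M` vanish;
* `exists_eq_sum_smul_hasseDeriv_of_isDiffOpLE`, `diffOp_eq_span_hasseDeriv` — **every differential
  operator of order `≤ n` of `A⟦X⟧` relative to `A` is a (unique) `A⟦X⟧`-combination of the `Δ_α`,
  `|α| ≤ n`**: degree peeling `E_{k+1} = E_k + Σ_{|α|=k} (D − E_k)(X^α) Δ_α` exactly as in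
  `Resolution.exists_hasseSchmidtDiff_sub_apply_monomial_eq_zero`, then the uniqueness lemma.

So `Diff^{≤ n}_{A⟦X⟧/A}` is FREE on `{Δ_α : |α| ≤ n}` (EGA IV₄ 16.11.2: «les `D_p` tels que `|p| ≤ m` forment
une base du `𝒪_U`-Module `Diff^m_{U/S}`», stated there for `U` smooth over `S` with local coordinates; the
formal-power-series ring is the completed local model). Everything is PROVED; no definitions, no facts.

Bearing (index only; nothing of it is asserted): Hironaka 2005 [24] Def. 9.2 («diff-regular» retraction:
`Diff_{𝒪_{Z,η}/Im(ι_η)}` freely generated by `∂_α` with (9.3) `∂_α(y^β) = C(β,α) y^{β−α}`) is, for the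
completed pair `R̂ ≅ ι(Ŝ)⟦y⟧` of Def. 9.4 / Lemma 9.2 (tree: `Resolution.PowerSeriesOverRetract`), exactly
`diffOp_eq_span_hasseDeriv` + `linearIndependent_hasseDeriv` + the tree's `hasseDeriv_monomial`.

## References

* A. Grothendieck, J. Dieudonné, ÉGA IV₄, Publ. Math. IHÉS 32 (1967), Thm. 16.11.2 with (16.11.2.1)
  (held: `paper:doi-10-1007-bf02732123`, PDF p.53). [EGAIV4]
* N. Bourbaki, *Algèbre commutative*, Ch. III §4 no. 5 (the `Δ_α`). [Bourbaki1989CommAlg]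
* H. Hironaka, Sémin. Congr. 10 (2005), Def. 9.2 (9.3) p.111, Lemma 10.3 (10.2) p.116. [Hironaka2005]
-/

noncomputable section

namespace Literature.RingTheory.MvPowerSeries

open _root_.MvPowerSeries Finset
open Literature.AlgebraicGeometry.Resolution (commMul commMul_apply IsDiffOpLE diffOp mem_diffOp_iff
  isDiffOpLE_zero_iff_eq_mulLeft)

universe u v

variable {A : Type u} [CommRing A] {τ : Type v} [Fintype τ] [DecidableEq τ]

/-! ### Values on monomials (from `HasseDerivOrder.lean` / `HasseDerivFrobenius.lean`) -/

omit [Fintype τ] [DecidableEq τ] in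
/-- `Δ_β (X^β) = 1`. [cite: EGAIV4, Thm. 16.11.2 (16.11.2.1)] -/
private theorem hasseDeriv_monomial_self_one (β : τ →₀ ℕ) :
    hasseDeriv β (monomial β (1 : A)) = 1 := by
  rw [hasseDeriv_monomial_self', monomial_zero_one]

omit [Fintype τ] [DecidableEq τ] in
/-- `X_i · (c X^β) = c X^{e_i + β}`. [folklore] -/
private theorem X_mul_monomial (i : τ) (β : τ →₀ ℕ) (c : A) :
    (X i : MvPowerSeries τ A) * monomial β c = monomial (Finsupp.single i 1 + β) c := by
  rw [X_def, monomial_mul_monomial, one_mul]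

omit [Fintype τ] [DecidableEq τ] in
/-- `α ≤ β ⇒ |α| ≤ |β|`. [folklore] -/
private theorem degree_le_degree_of_le {α β : τ →₀ ℕ} (h : α ≤ β) : α.degree ≤ β.degree := by
  have hβ : α + (β - α) = β := add_tsub_cancel_of_le h
  have := congrArg Finsupp.degree hβ
  rw [map_add] at this
  omega

omit [Fintype τ] [DecidableEq τ] in
/-- `α ≤ β` and `|α| = |β|` force `α = β`. [folklore] -/
private theorem eq_of_le_of_degree_eq {α β : τ →₀ ℕ} (h : α ≤ β) (hd : α.degree = β.degree) :
    α = β := by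
  have hβ : α + (β - α) = β := add_tsub_cancel_of_le h
  have h0 : (β - α).degree = 0 := by
    have := congrArg Finsupp.degree hβ
    rw [map_add, hd] at this
    omega
  rw [Finsupp.degree_eq_zero_iff] at h0
  rw [← hβ, h0, add_zero]

/-- `Finset.univ.finsuppAntidiag k` is the set of exponents of degree exactly `k`. [folklore] -/
private theorem mem_finsuppAntidiag_univ_iff {k : ℕ} {α : τ →₀ ℕ} :
    α ∈ (Finset.univ : Finset τ).finsuppAntidiag k ↔ α.degree = k := by
  rw [Finset.mem_finsuppAntidiag, Finsupp.degree_eq_sum]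
  simp

/-! ### Linear independence of the `Δ_α` over `A⟦X⟧` -/

omit [Fintype τ] [DecidableEq τ] in
/-- **The divided derivatives `Δ_α`, `α ∈ ℕ^τ`, are linearly independent over `A⟦X⟧`**: if a finite
combination `Σ c_α Δ_α` vanishes then, evaluating on `X^β` for `β` of least degree with `c_β ≠ 0`,
`0 = Σ_{α ≤ β} c_α C(β,α) X^{β−α} = c_β`. (The «forment une base» half of EGA IV₄ 16.11.2 giving
uniqueness of the coefficients; any index type `τ`.) [cite: EGAIV4, Thm. 16.11.2] -/
theorem linearIndependent_hasseDeriv :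
    LinearIndependent (MvPowerSeries τ A) (fun α : τ →₀ ℕ => hasseDeriv (A := A) α) := by
  classical
  rw [linearIndependent_iff']
  intro S c hS
  -- by strong induction on the degree
  suffices h : ∀ (k : ℕ) (α : τ →₀ ℕ), α ∈ S → α.degree = k → c α = 0 from
    fun α hα => h _ α hα rfl
  intro k
  induction k using Nat.strong_induction_on with
  | _ k ih =>
    intro β hβ hβk
    have happ := congrArg (fun D : MvPowerSeries τ A →ₗ[A] MvPowerSeries τ A => D (monomial β 1)) hS
    simp only [LinearMap.sum_apply, LinearMap.smul_apply, LinearMap.zero_apply, smul_eq_mul] at happ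
    rw [Finset.sum_eq_single β] at happ
    · rwa [hasseDeriv_monomial_self_one, mul_one] at happ
    · intro α hα hne
      by_cases hle : α ≤ β
      · have hlt : α.degree < k := by
          rcases (degree_le_degree_of_le hle).lt_or_eq with h | h
          · omega
          · exact absurd (eq_of_le_of_degree_eq hle h) hne
        rw [ih _ hlt α hα rfl, zero_mul]
      · rw [hasseDeriv_monomial_of_not_le' hle, mul_zero]
    · intro h
      exact absurd hβ h

/-! ### `(X)`-adic approximation: an operator commuting with the `X_i` and killing `1` is zero -/

/-- Every power series splits as `f = f(0) + Σ_i X_i · g_i` (finitely many variables): attach each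
monomial `X^β`, `β ≠ 0`, to one chosen variable dividing it (engine lemma). [folklore] -/
private theorem exists_eq_C_add_sum_X_mul (f : MvPowerSeries τ A) :
    ∃ g : τ → MvPowerSeries τ A, f = C (constantCoeff f) + ∑ i, X i * g i := by
  classical
  -- a chosen variable `pick β` occurring in `β ≠ 0`
  let pick : (τ →₀ ℕ) → Option τ := fun β =>
    if h : ∃ i, β i ≠ 0 then some (Classical.choose h) else none
  have hpick : ∀ β : τ →₀ ℕ, β ≠ 0 → ∃ j, pick β = some j ∧ β j ≠ 0 := by
    intro β hβ
    have h : ∃ i, β i ≠ 0 := by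
      by_contra hcon
      push Not at hcon
      exact hβ (Finsupp.ext hcon)
    exact ⟨Classical.choose h, by simp only [pick, dif_pos h], Classical.choose_spec h⟩
  set g : τ → MvPowerSeries τ A := fun i γ =>
    if pick (γ + Finsupp.single i 1) = some i then coeff (γ + Finsupp.single i 1) f else 0 with hg
  refine ⟨g, ?_⟩
  ext β
  rw [map_add, map_sum, coeff_C]
  by_cases hβ : β = 0
  · subst hβ
    rw [if_pos rfl, Finset.sum_eq_zero fun i _ => coeff_zero_X_mul _ i, add_zero,
      coeff_zero_eq_constantCoeff_apply]
  · rw [if_neg hβ, zero_add]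
    obtain ⟨j, hj, hβj⟩ := hpick β hβ
    have hjle : Finsupp.single j 1 ≤ β := Finsupp.single_le_iff.mpr (Nat.one_le_iff_ne_zero.mpr hβj)
    have hgval : ∀ (i : τ) (γ : τ →₀ ℕ), coeff γ (g i) =
        if pick (γ + Finsupp.single i 1) = some i then coeff (γ + Finsupp.single i 1) f else 0 :=
      fun i γ => by rw [hg, coeff_apply]
    have hterm : ∀ i, coeff β ((X i : MvPowerSeries τ A) * g i) =
        if Finsupp.single i 1 ≤ β then (if pick β = some i then coeff β f else 0) else 0 := by
      intro i
      rw [X_def, coeff_monomial_mul, one_mul]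
      by_cases hi : Finsupp.single i 1 ≤ β
      · rw [if_pos hi, if_pos hi, hgval, tsub_add_cancel_of_le hi]
      · rw [if_neg hi, if_neg hi]
    rw [Finset.sum_congr rfl fun i _ => hterm i, Finset.sum_eq_single j]
    · rw [if_pos hjle, if_pos hj]
    · intro i _ hne
      by_cases hi : Finsupp.single i 1 ≤ β
      · rw [if_pos hi, if_neg]
        rw [hj]
        exact fun h => hne (Option.some_injective _ h).symm
      · rw [if_neg hi]
    · intro h
      exact absurd (Finset.mem_univ j) h

omit [Fintype τ] [DecidableEq τ] in
/-- `|β − e_i| = |β| − 1` when `X_i ∣ X^β`. [folklore] -/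
private theorem degree_tsub_single {β : τ →₀ ℕ} {i : τ} (h : Finsupp.single i 1 ≤ β) :
    (β - Finsupp.single i 1).degree + 1 = β.degree := by
  have hβ : Finsupp.single i 1 + (β - Finsupp.single i 1) = β := add_tsub_cancel_of_le h
  have := congrArg Finsupp.degree hβ
  rw [map_add, Finsupp.degree_single] at this
  omega

/-- An `A`-linear endomorphism `E` of `A⟦X⟧` with `E(X_i t) = X_i E(t)` for all `i` and `E(1) = 0`
vanishes: `E(f) = Σ_i X_i E(g_i)` for `f = f(0) + Σ X_i g_i`, so by induction on `M` every coefficient of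
degree `< M` of every `E f` is zero (engine lemma). [folklore] -/
private theorem eq_zero_of_apply_X_mul_of_apply_one {E : MvPowerSeries τ A →ₗ[A] MvPowerSeries τ A}
    (hX : ∀ (i : τ) (t : MvPowerSeries τ A), E (X i * t) = X i * E t) (h1 : E 1 = 0) : E = 0 := by
  classical
  have key : ∀ (M : ℕ) (f : MvPowerSeries τ A) (β : τ →₀ ℕ), β.degree < M → coeff β (E f) = 0 := by
    intro M
    induction M with
    | zero => intro f β hβ; exact absurd hβ (Nat.not_lt_zero _)
    | succ M ih =>
      intro f β hβ
      obtain ⟨g, hg⟩ := exists_eq_C_add_sum_X_mul f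
      have hC : E (C (constantCoeff f)) = 0 := by
        rw [← mul_one (C (constantCoeff f)), ← smul_eq_C_mul, map_smul, h1, smul_zero]
      rw [hg, map_add, hC, zero_add, map_sum, map_sum]
      refine Finset.sum_eq_zero fun i _ => ?_
      rw [hX, X_def, coeff_monomial_mul, one_mul]
      by_cases hi : Finsupp.single i 1 ≤ β
      · rw [if_pos hi]
        refine ih (g i) _ ?_
        have := degree_tsub_single hi
        omega
      · rw [if_neg hi]
  refine LinearMap.ext fun f => ?_
  ext β
  rw [LinearMap.zero_apply, map_zero]
  exact key (β.degree + 1) f β (Nat.lt_succ_self _)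

/-! ### Uniqueness: operators of order `≤ n` are determined by the monomials of degree `≤ n` -/

/-- **An operator of order `≤ n` on `A⟦X⟧` vanishing on all monomials of degree `≤ n` is zero.**
Induction on `n`: the commutators `[E, X_i]` have order `≤ n − 1` and vanish on the monomials of degree
`≤ n − 1`, hence vanish; so `E` commutes with the `X_i`, kills `1`, and is zero by
`eq_zero_of_apply_X_mul_of_apply_one`. [cite: EGAIV4, Thm. 16.11.2 (uniqueness of D = Σ a_p D_p)] -/
theorem eq_zero_of_isDiffOpLE_of_apply_monomial_eq_zero :
    ∀ (n : ℕ) {E : MvPowerSeries τ A →ₗ[A] MvPowerSeries τ A}, IsDiffOpLE A n E →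
      (∀ β : τ →₀ ℕ, β.degree ≤ n → E (monomial β 1) = 0) → E = 0
  | 0, E, hE, h0 => by
    rw [isDiffOpLE_zero_iff_eq_mulLeft.1 hE]
    have h1 : E 1 = 0 := by simpa using h0 0 (by simp)
    rw [h1]
    exact LinearMap.mulLeft_zero_eq_zero _ _
  | n + 1, E, hE, h0 => by
    have hF : ∀ i : τ, commMul A E (X i) = 0 := fun i =>
      eq_zero_of_isDiffOpLE_of_apply_monomial_eq_zero n (hE (X i)) fun β hβ => by
        have hdeg : (Finsupp.single i 1 + β).degree ≤ n + 1 := by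
          rw [map_add, Finsupp.degree_single]; omega
        rw [commMul_apply, X_mul_monomial, h0 _ hdeg, h0 β (by omega), mul_zero, sub_zero]
    have hX : ∀ (i : τ) (t : MvPowerSeries τ A), E (X i * t) = X i * E t := fun i t => by
      have := congrArg (fun D : MvPowerSeries τ A →ₗ[A] MvPowerSeries τ A => D t) (hF i)
      simpa [commMul_apply, sub_eq_zero] using this
    have h1 : E 1 = 0 := by simpa using h0 0 (by simp)
    exact eq_zero_of_apply_X_mul_of_apply_one hX h1

/-! ### Spanning: degree peeling -/

/-- **Degree peeling** (power series): for every `A`-linear `D` and `k ≤ n + 1` there are coefficients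
`c_α`, supported in degrees `< k`, with `D − Σ_{|α| ≤ n} c_α Δ_α` vanishing on all monomials of degree `< k`
— `E_{k+1} = E_k + Σ_{|α| = k} (D − E_k)(X^α) · Δ_α`, since `Δ_α(X^β) = δ_{αβ}` for `|α| = |β|` and `= 0`
for `|α| > |β|`. [cite: EGAIV4, Thm. 16.11.2 (proof)] -/
theorem exists_sum_smul_hasseDeriv_sub_apply_monomial_eq_zero (n : ℕ)
    (D : MvPowerSeries τ A →ₗ[A] MvPowerSeries τ A) :
    ∀ k : ℕ, k ≤ n + 1 → ∃ c : (τ →₀ ℕ) → MvPowerSeries τ A,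
      (∀ α, k ≤ α.degree → c α = 0) ∧
      ∀ β : τ →₀ ℕ, β.degree < k →
        ((D - ∑ α ∈ (Finset.range (n + 1)).biUnion
            (fun j => (Finset.univ : Finset τ).finsuppAntidiag j), c α • hasseDeriv (A := A) α :
            MvPowerSeries τ A →ₗ[A] MvPowerSeries τ A) (monomial β 1)) = 0
  | 0, _ => ⟨0, fun _ _ => rfl, fun β hβ => absurd hβ (Nat.not_lt_zero _)⟩
  | k + 1, hk => by
    classical
    obtain ⟨c, hc, hkill⟩ := exists_sum_smul_hasseDeriv_sub_apply_monomial_eq_zero n D k (by omega)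
    set S := (Finset.range (n + 1)).biUnion (fun j => (Finset.univ : Finset τ).finsuppAntidiag j)
      with hS
    have hmemS : ∀ α : τ →₀ ℕ, α ∈ S ↔ α.degree ≤ n := fun α => by
      simp only [hS, Finset.mem_biUnion, Finset.mem_range, mem_finsuppAntidiag_univ_iff]
      constructor
      · rintro ⟨j, hj, hja⟩; omega
      · intro h; exact ⟨α.degree, by omega, rfl⟩
    set E := ∑ α ∈ S, c α • hasseDeriv (A := A) α with hE
    -- new coefficients: add `(D − E)(X^α)` in degree `k`
    refine ⟨fun α => if α.degree = k then c α + (D - E) (monomial α 1) else c α, ?_, ?_⟩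
    · intro α hα
      have hne : α.degree ≠ k := by omega
      dsimp only
      rw [if_neg hne]
      exact hc α (by omega)
    · intro β hβ
      -- the new operator is `E + Σ_{|α| = k} (D − E)(X^α) Δ_α`
      have hsum : ∑ α ∈ S, (if α.degree = k then c α + (D - E) (monomial α 1) else c α) •
            hasseDeriv (A := A) α =
          E + ∑ α ∈ S, (if α.degree = k then (D - E) (monomial α 1) else 0) • hasseDeriv α := by
        rw [hE, ← Finset.sum_add_distrib]
        refine Finset.sum_congr rfl fun α _ => ?_
        split_ifs with h
        · rw [add_smul]
        · rw [zero_smul, add_zero]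
      rw [hsum]
      have hsplit : (D - (E + ∑ α ∈ S, (if α.degree = k then (D - E) (monomial α 1) else 0) •
            hasseDeriv (A := A) α)) (monomial β 1) =
          (D - E) (monomial β 1) -
            ∑ α ∈ S, (if α.degree = k then (D - E) (monomial α 1) else 0) *
              hasseDeriv α (monomial β 1) := by
        simp only [LinearMap.sub_apply, LinearMap.add_apply, LinearMap.sum_apply,
          LinearMap.smul_apply, smul_eq_mul]
        ring
      rw [hsplit, sub_eq_zero]
      rcases Nat.lt_succ_iff_lt_or_eq.mp hβ with hlt | heq
      · -- degree `< k`: IH, and only `|α| = k > |β|` could contribute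
        rw [hkill β hlt, eq_comm]
        refine Finset.sum_eq_zero fun α _ => ?_
        by_cases hαk : α.degree = k
        · rw [hasseDeriv_monomial_of_not_le' ?_, mul_zero]
          intro hle
          have := degree_le_degree_of_le hle
          omega
        · rw [if_neg hαk, zero_mul]
      · -- degree `= k`: only `α = β` contributes, with `Δ_β(X^β) = 1`
        have hβS : β ∈ S := (hmemS β).mpr (by omega)
        rw [Finset.sum_eq_single β]
        · rw [if_pos heq, hasseDeriv_monomial_self_one, mul_one]
        · intro α _ hne
          by_cases hαk : α.degree = k
          · rw [hasseDeriv_monomial_of_not_le' ?_, mul_zero]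
            intro hle
            exact hne (eq_of_le_of_degree_eq hle (by rw [hαk, heq]))
          · rw [if_neg hαk, zero_mul]
        · intro hβ'
          exact absurd hβS hβ'

/-- **EGA IV₄ Thm. 16.11.2 for `A⟦X_s : s ∈ τ⟧`, `τ` finite (spanning form): every differential operator of
order `≤ n` relative to `A` is `Σ_{|α| ≤ n} c_α Δ_α` with `c_α ∈ A⟦X⟧`** (unique by
`linearIndependent_hasseDeriv`). [cite: EGAIV4, Thm. 16.11.2] -/
theorem exists_eq_sum_smul_hasseDeriv_of_isDiffOpLE {n : ℕ}
    {D : MvPowerSeries τ A →ₗ[A] MvPowerSeries τ A} (hD : IsDiffOpLE A n D) :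
    ∃ c : (τ →₀ ℕ) → MvPowerSeries τ A,
      D = ∑ α ∈ (Finset.range (n + 1)).biUnion
        (fun j => (Finset.univ : Finset τ).finsuppAntidiag j), c α • hasseDeriv α := by
  classical
  obtain ⟨c, -, hkill⟩ :=
    exists_sum_smul_hasseDeriv_sub_apply_monomial_eq_zero n D (n + 1) le_rfl
  refine ⟨c, ?_⟩
  set S := (Finset.range (n + 1)).biUnion (fun j => (Finset.univ : Finset τ).finsuppAntidiag j)
    with hS
  have hmemS : ∀ α : τ →₀ ℕ, α ∈ S → α.degree ≤ n := fun α hα => by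
    simp only [hS, Finset.mem_biUnion, Finset.mem_range, mem_finsuppAntidiag_univ_iff] at hα
    obtain ⟨j, hj, hja⟩ := hα
    omega
  have hE : IsDiffOpLE A n (∑ α ∈ S, c α • hasseDeriv (A := A) α) :=
    IsDiffOpLE.sum _ fun α hα => IsDiffOpLE.smul _ (isDiffOpLE_hasseDeriv n α (hmemS α hα))
  have h0 := eq_zero_of_isDiffOpLE_of_apply_monomial_eq_zero n (IsDiffOpLE.sub hD hE)
    fun β hβ => hkill β (Nat.lt_succ_of_le hβ)
  rwa [sub_eq_zero] at h0

/-- **`Diff^{≤ n}_{A⟦X⟧/A}` is the `A⟦X⟧`-span of the `Δ_α`, `|α| ≤ n`** — with `linearIndependent_hasseDeriv`: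
`Diff^{≤ n}` is FREE on `{Δ_α : |α| ≤ n}` (EGA IV₄ 16.11.2, formal-power-series model; Hironaka 2005
Def. 9.2 (2) for `K[[w, y]] ⊃ K[[y]]`). [cite: EGAIV4, Thm. 16.11.2] -/
theorem diffOp_eq_span_hasseDeriv (n : ℕ) :
    diffOp A (MvPowerSeries τ A) n =
      Submodule.span (MvPowerSeries τ A) ((fun α : τ →₀ ℕ => hasseDeriv (A := A) α) '' {α | α.degree ≤ n}) := by
  classical
  refine le_antisymm (fun D hD => ?_) (Submodule.span_le.mpr ?_)
  · obtain ⟨c, hc⟩ := exists_eq_sum_smul_hasseDeriv_of_isDiffOpLE (mem_diffOp_iff.mp hD)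
    rw [hc]
    refine Submodule.sum_mem _ fun α hα => Submodule.smul_mem _ _ (Submodule.subset_span ⟨α, ?_, rfl⟩)
    simp only [Finset.mem_biUnion, Finset.mem_range, mem_finsuppAntidiag_univ_iff] at hα
    obtain ⟨j, hj, hja⟩ := hα
    show α.degree ≤ n
    omega
  · rintro _ ⟨α, hα, rfl⟩
    exact isDiffOpLE_hasseDeriv n α hα

/-- Membership form: `D ∈ Diff^{≤ n}_{A⟦X⟧/A}` iff `D = Σ_{|α| ≤ n} c_α Δ_α` for some coefficients.
[cite: EGAIV4, Thm. 16.11.2] -/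
theorem isDiffOpLE_iff_exists_eq_sum_smul_hasseDeriv {n : ℕ}
    {D : MvPowerSeries τ A →ₗ[A] MvPowerSeries τ A} :
    IsDiffOpLE A n D ↔ ∃ c : (τ →₀ ℕ) → MvPowerSeries τ A,
      D = ∑ α ∈ (Finset.range (n + 1)).biUnion
        (fun j => (Finset.univ : Finset τ).finsuppAntidiag j), c α • hasseDeriv α := by
  classical
  refine ⟨exists_eq_sum_smul_hasseDeriv_of_isDiffOpLE, ?_⟩
  rintro ⟨c, rfl⟩
  refine IsDiffOpLE.sum _ fun α hα => IsDiffOpLE.smul _ (isDiffOpLE_hasseDeriv n α ?_)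
  simp only [Finset.mem_biUnion, Finset.mem_range, mem_finsuppAntidiag_univ_iff] at hα
  obtain ⟨j, hj, hja⟩ := hα
  omega

/-- **An operator of order `≤ n` on `A⟦X⟧` is determined by its values on the monomials of degree `≤ n`.**
[cite: EGAIV4, Thm. 16.11.2] -/
theorem eq_of_isDiffOpLE_of_apply_monomial_eq {n : ℕ} {D E : MvPowerSeries τ A →ₗ[A] MvPowerSeries τ A}
    (hD : IsDiffOpLE A n D) (hE : IsDiffOpLE A n E)
    (h : ∀ β : τ →₀ ℕ, β.degree ≤ n → D (monomial β 1) = E (monomial β 1)) : D = E := by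
  have h0 := eq_zero_of_isDiffOpLE_of_apply_monomial_eq_zero n (IsDiffOpLE.sub hD hE) fun β hβ => by
    rw [LinearMap.sub_apply, h β hβ, sub_self]
  rwa [sub_eq_zero] at h0

end Literature.RingTheory.MvPowerSeries

end
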